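import Summits.HodgeConjecture.HodgeConjecture.Theses.PadicSemiregularLift
import Summits.HodgeConjecture.HodgeConjecture.Theorems.PadicSemiregularLiftHodgeBeyondAnchorsMotivatedSplit
import Summits.HodgeConjecture.HodgeConjecture.Theorems.HeckePrymWeilSummitOffWeilSectorCupProductOfRoberts
import Literature.AlgebraicGeometry.Motives.GenericProjectionCone
import HarnessLib

/-!
# Crux `HodgeBeyondAnchors` (stmt-HodgeConjecture-14054), line `andre-motivated-split`: the crux from Roberts' generic projection, (HM) and (B)

Lead c2 of the crux line (`Cruxes/HodgeBeyondAnchors/Lines/andre_motivated_split.lean`). The line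
splits the Hodge conjecture off the anchors (`HodgeBeyondAnchors`, kernel-equivalent to the summit)
along André's chain `algebraic ⊆ motivated ⊆ Hodge` into (HM) Hodge classes are motivated
(stmt-HodgeConjecture-17488), (B) the Lefschetz standard conjecture (stmt-HodgeConjecture-17489) and
(Δ) the multiplicativity of the coniveau carrier `Nˡ H²ˡ ∪ Nᵏ H²ᵏ ⊆ Nˡ⁺ᵏ` (Voisin II Prop. 9.20, the
tree's named fact `Voisin2003_cupProduct_algebraicClasses`). The theorem-grade part (Δ) is now reduced,
kernel-checked, to ONE named fact of pure algebraic geometry,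
`Motives.Roberts1972_genericProjection` (Fulton, *Intersection Theory* Ex. 11.4.1 (a)–(b); Roberts,
*Chow's moving lemma* (1972), Main Lemma; filed by this line, p141863): the cone step of Chow's
moving lemma on the coniveau carrier was assembled by this line from its landed stubs (A)
`stub_supportedClass_ne_zero` (p140150), (T) `stub_thomLineTransport` (p140530), (Θ)
`stub_coneTransport` (p141205), (E) `stub_localHomeomorph_of_smooth` (p141516), and the composition
`Roberts1972_genericProjection → hstep → Voisin2003_cupProduct_algebraicClasses` is LANDED as
`Theorems.coneStep_of_roberts1972` / `Theorems.voisin2003_of_roberts1972`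
(`Theorems/HeckePrymWeilSummitOffWeilSectorCupProductOfRoberts.lean`, the twin line of route
`HeckePrymWeil`, which imported this line's glue). This file records the consequences for THIS crux
and its neighbours:

* `stub_hodgeBeyondAnchors_of_genericProjection` — the registered composition stub (C) of the line:
  `Roberts1972_genericProjection → (HM) → (B) → HodgeBeyondAnchors`, through the landed split glue
  `hodgeBeyondAnchors_of_motivated_of_standardConjectureB_of_cupProduct` (p137440);
* `diagonalPullbackAlgebraic_of_genericProjection` — (Δ) = the support item
  `MotivatedLefschetzSplit.DiagonalPullbackAlgebraic` (stmt-HodgeConjecture-17490) VERBATIM from the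
  named fact (`diagonalPullbackAlgebraic_iff_cupProduct`, p137440);
* `fulton1998_map_mem_algebraicClasses_of_genericProjection` — the named fact
  `fulton1998_map_mem_algebraicClasses` (Fulton Cor. 19.2 on the coniveau carrier: pull-back of
  algebraic classes along any morphism of smooth projective varieties) from the named fact
  (`diagonalPullbackAlgebraic_iff_fulton1998`, p137440).

All theorems here are sorry-free and CONDITIONAL on `Roberts1972_genericProjection` (a theorem in
print, unproved in the tree; plan: `Cruxes/HodgeBeyondAnchors/ROBERTS-PLAN.md`, first piece landed as
`Motives/GenericProjectionMultiplicityOne`); (HM), (B) enter as hypotheses verbatim (open conjectures).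

## References
* [VoisinHodgeII2003] C. Voisin, Hodge Theory and Complex Algebraic Geometry II, CUP 2003, §9.2.4 Prop. 9.20–9.21, Lemma 9.22.
* [Fulton1998] W. Fulton, Intersection Theory, 2nd ed., Springer 1998, §11.4 Ex. 11.4.1, §19.2 Cor. 19.2.
* [Roberts1972] J. Roberts, Chow's moving lemma, Algebraic Geometry (Oslo 1970), 1972, Main Lemma.
* [Andre1996Motifs] Y. André, Pour une théorie inconditionnelle des motifs, Publ. Math. IHÉS 83 (1996), §0.3–0.4.

#harness_tags algebraic_geometry.hodge_theory, algebraic_topology.singular_cohomology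
-/

-- every declaration of this problem lives in `Summit.HodgeConjecture.HodgeConjecture.…` (summit = sub-problem)
set_option linter.dupNamespace false

noncomputable section

open CategoryTheory AlgebraicGeometry MonoidalCategory CartesianMonoidalCategory Order Set
open Literature.AlgebraicTopology.SingularHomology Literature.Geometry.Kaehler
open Literature.AlgebraicGeometry.Motives Literature.AlgebraicGeometry.HodgeTheory

namespace Summit.HodgeConjecture.HodgeConjecture.Theorems.HodgeBeyondAnchors

open Summit.HodgeConjecture.HodgeConjecture.Theses.PadicSemiregularLift
open Summit.HodgeConjecture.HodgeConjecture.Theorems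

/-- **(Δ) in full from Roberts' generic projection** — verbatim the support item
`MotivatedLefschetzSplit.DiagonalPullbackAlgebraic` (stmt-HodgeConjecture-17490): for `V` smooth
projective over `ℂ` and every `p`, `Δ^*` carries `Nᵖ H²ᵖ(V × V)` into `Nᵖ H²ᵖ(V)`. From
`voisin2003_of_roberts1972` through `diagonalPullbackAlgebraic_iff_cupProduct` (p137440). CONDITIONAL
on the named fact. [cite: VoisinHodgeII2003, §9.2.4 Prop. 9.21 (i)] -/
theorem diagonalPullbackAlgebraic_of_genericProjection (hGP : Roberts1972_genericProjection) :
    ∀ ⦃d : ℕ⦄ ⦃V : SchemeOver ℂ⦄, IsSmoothProjective d V → ∀ (p : ℕ)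
      ⦃c : complexBetti (V ⊗ V) (2 * p)⦄, c ∈ algebraicClasses (V ⊗ V) p →
        complexBetti.map (lift (𝟙 V) (𝟙 V)) (2 * p) c ∈ algebraicClasses V p :=
  diagonalPullbackAlgebraic_iff_cupProduct.2 (voisin2003_of_roberts1972 hGP)

/-- **Fulton Cor. 19.2 (pull-back of algebraic classes along any morphism of smooth projective
varieties) on the coniveau carrier — the tree's named fact `fulton1998_map_mem_algebraicClasses` —
from Roberts' generic projection** (`diagonalPullbackAlgebraic_iff_fulton1998`, p137440).
CONDITIONAL on the named fact. [cite: Fulton1998, §19.2 Cor. 19.2] -/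
theorem fulton1998_map_mem_algebraicClasses_of_genericProjection (hGP : Roberts1972_genericProjection) :
    fulton1998_map_mem_algebraicClasses :=
  diagonalPullbackAlgebraic_iff_fulton1998.1 (diagonalPullbackAlgebraic_of_genericProjection hGP)

/-- **(C) The crux from Roberts' generic projection, (HM) and (B)** — the registered composition stub
of the line: `Roberts1972_genericProjection → HodgeClassesMotivated → LefschetzStandardB →
HodgeBeyondAnchors`, through the landed split glue
`hodgeBeyondAnchors_of_motivated_of_standardConjectureB_of_cupProduct` (p137440: under (B) André's
`A_mot = A`, so (HM) gives the deep-middle `(p,p)`-classes algebraic; the remaining degrees and the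
anchors are in the tree) fed with Voisin II Prop. 9.20 from the cone step
(`voisin2003_of_roberts1972`). CONDITIONAL on the named fact; (HM), (B) are the open conjectures
stmt-HodgeConjecture-17488 / 17489, taken as hypotheses verbatim.
[cite: Andre1996Motifs, §0.3–0.4] [cite: VoisinHodgeII2003, §9.2.4 Prop. 9.20] -/
theorem stub_hodgeBeyondAnchors_of_genericProjection :
    Roberts1972_genericProjection →
    (∀ ⦃n : ℕ⦄ ⦃X : SchemeOver ℂ⦄, IsSmoothProjective n X →
      ∀ p : ℕ, 2 ≤ p → 2 * p ≤ n →
        ∀ c : complexBetti X (2 * p), IsRationalClass c → IsOfHodgeType n X (2 * p) p p c →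
          c ∈ motivatedClasses n X p) →
    (∀ (d : ℕ) (Z : SchemeOver ℂ) (η : complexBetti Z 2), IsSmoothProjective d Z →
      StandardConjectureBStar d Z η) →
    HodgeBeyondAnchors :=
  fun hGP hHM hB ↦
    hodgeBeyondAnchors_of_motivated_of_standardConjectureB_of_cupProduct hHM hB
      (voisin2003_of_roberts1972 hGP)

end Summit.HodgeConjecture.HodgeConjecture.Theorems.HodgeBeyondAnchors

end
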